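import Summits.BirchSwinnertonDyer.BirchSwinnertonDyer.Theorems.CyclotomicUntwistAmiceRationality
import HarnessLib

/-!
# GZ₃, pBSD₃ and MATCH for the CONJUGATE datum `(η̄, ᾱ, ψ̄)` follow from those for `(η, α, ψ)`:
# only one of the two conjugate `3`-adic Gross–Zagier statements of the route is a crux

Cell `pub/bsd-wall` (D-0145 line `route-BirchSwinnertonDyer-CyclotomicUntwist`), width seat
`bsd-line-cycu-p5` g5. THEOREMS ONLY (no definition, no named fact, no `sorry`); helper `--supports`
K1 = stmt-BirchSwinnertonDyer-21580 (`PSRankOneLowerHalfAtThree`). BSD is not proved by this file and no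
crux of the route is proved by it; K1/K2 stay open and WHOLE; nothing here asserts GZ₃ or pBSD₃.

WHAT. The separated closer `CyclotomicUntwistFiniteSlopeSeparated.psRankOne_halves_of_separated` (cycu-p3) takes,
per principal-series row and per admissible untwist datum `(η, α, 𝓛)`, the hypotheses
GZ₃ `c₁(𝓛) = κ_an · q · ι h_ψ(P,P)`, pBSD₃ `‖c₁(𝓛)‖ = ‖κ_alg‖ · ‖#Ш∏c/#tors²‖ · ‖ι h_ψ(P,P)‖` and MATCH
`κ_an ≠ 0 ∧ ‖κ_alg‖ = ‖κ_an‖`, over coefficient data `(R = ℚ₃(ζ₃), ψ, σ, ι)` and a D2 line-height datum `Dh`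
(`PSLineHeightData`, axiom `conj : h_{χ∘σ} = σ ∘ h_χ`). By `CyclotomicUntwistAmiceRationality` the conjugate
untwisted `L`-function `𝓛^{η̄}_W = ι ∘ σ ∘ μ_K` has the `σ`-CONJUGATE Amice transform of `𝓛^{η}_W = ι ∘ μ_K`.
Hence (this file, `p = 3`, `K = ℚ₃(ζ₃) = CyclotomicField 3 ℚ_[3]`, `ι : K →ₐ[ℚ₃] ℂ₃`, `σ ∈ Aut(K/ℚ₃)` with
`η_K ∘ σ = η_K⁻¹`, `η_K` primitive mod `9`, `α_K ∉ {0, 3}`):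

* **`exists_conj_transfer_of_isPSCyclotomicLFunctionOf`** (no Carayol): given `μ = 𝓛^{η}_W` there is a conjugate
  `μ'` with `IsPSCyclotomicLFunctionOf W (η_K ∘ ι)⁻¹ (ι (σ α_K)) μ'` such that for EVERY datum `Dh`, character
  `ψ` mod `9`, points `P, Q`, constant `κ ∈ K` and `q ∈ ℚ`:
  GZ₃-transfer `c₁(μ) = ι κ · q · ι h_ψ(P,Q) ⟹ c₁(μ') = ι (σ κ) · q · ι h_{ψ∘σ}(P,Q)`;
  pBSD₃-transfer `‖c₁(μ)‖ = A · ‖ι h_ψ(P,Q)‖ ⟹ ‖c₁(μ')‖ = A · ‖ι h_{ψ∘σ}(P,Q)‖` (any real factor `A`);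
  MATCH-transfer `‖ι (σ κ)‖ = ‖ι κ‖`, `ι (σ κ) ≠ 0 ↔ ι κ ≠ 0` — and `h_{ψ∘σ} = h_{ψ̄}` when `ψ ∘ σ = ψ⁻¹`
  (`PSLineHeightData.pairing_inv_eq_of_ringHomComp_eq`), which the route's `σ` gives for `ψ³ = 1`
  (`PSConjugateLFunctionsThree.exists_algEquiv_ringHomComp_eq_inv_of_pow_six`).
* `conj_transfer_of_isPSCyclotomicLFunctionOf` — granted Carayol (`hlev`), the same for ANY `𝓛^{η̄}_W`.

WHY. The per-row cruxes GZ₃ / pBSD₃ / MATCH need only be proved for ONE untwisting character of each conjugate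
pair `{η, η̄}` (with the line `ψ` resp. `ψ̄`); the pins D4 must satisfy `κ_an(η̄, ᾱ) = ι σ ι⁻¹ κ_an(η, α)` on
`ι(K)`-valued constants and `‖κ_alg(η̄, ᾱ)‖ = ‖κ_alg(η, α)‖` — a refuter-grade consistency test of any proposed D4.

References: [cite: MazurTateTeitelbaum1986Invent, §I.10 and §I.13] · [cite: Benois2020, §0.3] ·
[cite: PerrinRiou1993AIF, Introduction].
-/

noncomputable section

open scoped MatrixGroups

open Filter Topology CongruenceSubgroup DirichletCharacter WeierstrassCurve Literature.NumberTheory.EllipticCurves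
  Literature.NumberTheory.EllipticCurves.ModularForms Literature.NumberTheory.IwasawaTheory
  Summit.BirchSwinnertonDyer.BirchSwinnertonDyer.Theorems.PSConjugateLFunctions
  Summit.BirchSwinnertonDyer.BirchSwinnertonDyer.Theorems.PSConjugateLFunctionsThree
  Summit.BirchSwinnertonDyer.BirchSwinnertonDyer.Theorems.PSAmiceRationality

-- single-conjunct summit: `Summit.BirchSwinnertonDyer.BirchSwinnertonDyer.…` repeats the name by design
set_option linter.dupNamespace false
set_option autoImplicit false

namespace Summit.BirchSwinnertonDyer.BirchSwinnertonDyer.Theorems.PSConjugateGrossZagier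

variable {W : WeierstrassCurve ℚ}
  (ι : CyclotomicField 3 ℚ_[3] →ₐ[ℚ_[3]] ℂ_[3])
  (ηK : DirichletCharacter (CyclotomicField 3 ℚ_[3]) (3 ^ 2)) (αK : CyclotomicField 3 ℚ_[3])
  (σ : CyclotomicField 3 ℚ_[3] ≃ₐ[ℚ_[3]] CyclotomicField 3 ℚ_[3])

/-! ### §1 Algebra of the transfer: one conjugate pair of identities in `ℚ₃(ζ₃)` -/

/-- **MATCH-transfer (norm)**: `‖ι (σ κ)‖ = ‖ι κ‖` for every `κ ∈ ℚ₃(ζ₃)` (all `ℚ₃`-embeddings induce the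
spectral norm). [cite: BoschGuntzerRemmert1984, §3.2.4 Thm. 2] -/
theorem norm_map_conj (κ : CyclotomicField 3 ℚ_[3]) : ‖ι (σ κ)‖ = ‖ι κ‖ := by
  haveI : Module.Finite ℚ_[3] (CyclotomicField 3 ℚ_[3]) :=
    IsCyclotomicExtension.finite {3} ℚ_[3] (CyclotomicField 3 ℚ_[3])
  haveI : Algebra.IsAlgebraic ℚ_[3] (CyclotomicField 3 ℚ_[3]) :=
    Algebra.IsAlgebraic.of_finite ℚ_[3] (CyclotomicField 3 ℚ_[3])
  exact norm_algHom_algEquiv ι σ κ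

/-- **MATCH-transfer (non-vanishing)**: `ι (σ κ) ≠ 0 ↔ ι κ ≠ 0`. [folklore] -/
theorem map_conj_ne_zero_iff (κ : CyclotomicField 3 ℚ_[3]) : ι (σ κ) ≠ 0 ↔ ι κ ≠ 0 := by
  rw [map_ne_zero_iff ι (ι : CyclotomicField 3 ℚ_[3] →+* ℂ_[3]).injective,
    map_ne_zero_iff σ σ.injective, map_ne_zero_iff ι (ι : CyclotomicField 3 ℚ_[3] →+* ℂ_[3]).injective]

/-- **GZ₃-transfer, algebraic core.** If `ι c = ι κ · q · ι h` and `ι' = ι ∘ σ`, then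
`ι (σ c) = ι (σ κ) · q · ι (σ h)` (`ι` injective, `σ` fixes `ℚ`). [folklore] -/
theorem map_conj_eq_of_eq {c κ h : CyclotomicField 3 ℚ_[3]} {q : ℚ}
    (hc : ι c = ι κ * (q : ℂ_[3]) * ι h) : ι (σ c) = ι (σ κ) * (q : ℂ_[3]) * ι (σ h) := by
  have h1 : c = κ * (q : CyclotomicField 3 ℚ_[3]) * h := by
    apply (ι : CyclotomicField 3 ℚ_[3] →+* ℂ_[3]).injective
    simp only [AlgHom.coe_toRingHom, map_mul, map_ratCast]
    exact hc
  rw [h1]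
  simp only [map_mul, map_ratCast]

/-! ### §2 The transfer for the conjugate untwisted `L`-function (no Carayol) -/

/-- **GZ₃ / pBSD₃ / MATCH TRANSFER TO THE CONJUGATE DATUM.** For `W/ℚ`, `ι : ℚ₃(ζ₃) →ₐ[ℚ₃] ℂ₃`,
`σ ∈ Aut(ℚ₃(ζ₃)/ℚ₃)` with `η_K ∘ σ = η_K⁻¹`, `η_K` primitive mod `9`, `α_K ∉ {0, 3}` and `μ = 𝓛^{η}_W` (datum
`(η_K ∘ ι, ι α_K)`): there is `μ'` with `IsPSCyclotomicLFunctionOf W (η_K ∘ ι)⁻¹ (ι (σ α_K)) μ'` (the conjugate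
`L`-function) such that, for every D2 datum `Dh` over `ℚ₃(ζ₃)`, every character `ψ` mod `9`, all points `P, Q`:
(GZ₃) `c₁(μ) = ι κ · q · ι h_ψ(P,Q) → c₁(μ') = ι (σ κ) · q · ι h_{ψ∘σ}(P,Q)` for all `κ ∈ ℚ₃(ζ₃)`, `q ∈ ℚ`;
(pBSD₃) `‖c₁(μ)‖ = A · ‖ι h_ψ(P,Q)‖ → ‖c₁(μ')‖ = A · ‖ι h_{ψ∘σ}(P,Q)‖` for all `A : ℝ`.  With D2's `conj`,
`h_{ψ∘σ} = σ ∘ h_ψ`, and `= h_{ψ̄}` when `ψ ∘ σ = ψ⁻¹`. [cite: MazurTateTeitelbaum1986Invent, §I.10 and §I.13] [cite: Benois2020, §0.3] -/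
theorem exists_conj_transfer_of_isPSCyclotomicLFunctionOf
    (hσ : ηK.ringHomComp (σ : CyclotomicField 3 ℚ_[3] →+* CyclotomicField 3 ℚ_[3]) = ηK⁻¹)
    (hη : ηK.IsPrimitive) (hα : αK ≠ 0) (hα3 : αK ≠ (3 : ℕ)) {μ : (n : ℕ) → ZMod (3 ^ n) → ℂ_[3]}
    (hμ : IsPSCyclotomicLFunctionOf W (ηK.ringHomComp (ι : CyclotomicField 3 ℚ_[3] →+* ℂ_[3])) (ι αK) μ) :
    ∃ μ' : (n : ℕ) → ZMod (3 ^ n) → ℂ_[3],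
      IsPSCyclotomicLFunctionOf W (ηK.ringHomComp (ι : CyclotomicField 3 ℚ_[3] →+* ℂ_[3]))⁻¹ (ι (σ αK))
        μ' ∧
      (∀ (Dh : W.PSLineHeightData (CyclotomicField 3 ℚ_[3]))
          (ψ : DirichletCharacter (CyclotomicField 3 ℚ_[3]) 9) (P Q : W.toAffine.Point)
          (κ : CyclotomicField 3 ℚ_[3]) (q : ℚ),
        gammaMahlerCoeff 3 μ 1 = ι κ * (q : ℂ_[3]) * ι (Dh.pairing ψ P Q) →
          gammaMahlerCoeff 3 μ' 1 = ι (σ κ) * (q : ℂ_[3]) *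
            ι (Dh.pairing (ψ.ringHomComp (σ : CyclotomicField 3 ℚ_[3] →+* CyclotomicField 3 ℚ_[3])) P Q)) ∧
      (∀ (Dh : W.PSLineHeightData (CyclotomicField 3 ℚ_[3]))
          (ψ : DirichletCharacter (CyclotomicField 3 ℚ_[3]) 9) (P Q : W.toAffine.Point) (A : ℝ),
        ‖gammaMahlerCoeff 3 μ 1‖ = A * ‖ι (Dh.pairing ψ P Q)‖ →
          ‖gammaMahlerCoeff 3 μ' 1‖ = A *
            ‖ι (Dh.pairing (ψ.ringHomComp (σ : CyclotomicField 3 ℚ_[3] →+* CyclotomicField 3 ℚ_[3])) P Q)‖) := by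
  obtain ⟨μK, c, -, hμK, hPS, hc, -⟩ :=
    exists_conj_gammaMahlerCoeff_of_isPSCyclotomicLFunctionOf ι ηK αK σ hσ hη hα hα3 hμ
  refine ⟨fun n s ↦ ι (σ (μK n s)), hPS, ?_, ?_⟩
  · intro Dh ψ P Q κ q hGZ
    rw [(hc 1).2, Dh.conj σ ψ P Q]
    rw [(hc 1).1] at hGZ
    exact map_conj_eq_of_eq ι σ hGZ
  · intro Dh ψ P Q A hB
    rw [(hc 1).2, Dh.conj σ ψ P Q, norm_map_conj ι σ, norm_map_conj ι σ, ← (hc 1).1, hB]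

/-- **The same with the inverse line `ψ̄ = ψ⁻¹`** when `ψ ∘ σ = ψ⁻¹` (the route's `σ` does this for every `ψ`
with `ψ³ = 1` or `ψ⁶ = 1`): GZ₃ for `(η, ψ)` with constant `ι κ` gives GZ₃ for `(η̄, ψ̄)` with constant
`ι (σ κ)`, and pBSD₃ transfers with the same real factor. [cite: Benois2020, §0.3] [cite: PerrinRiou1993AIF, Introduction] -/
theorem exists_conj_transfer_inv_of_isPSCyclotomicLFunctionOf
    (hσ : ηK.ringHomComp (σ : CyclotomicField 3 ℚ_[3] →+* CyclotomicField 3 ℚ_[3]) = ηK⁻¹)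
    (hη : ηK.IsPrimitive) (hα : αK ≠ 0) (hα3 : αK ≠ (3 : ℕ)) {μ : (n : ℕ) → ZMod (3 ^ n) → ℂ_[3]}
    (hμ : IsPSCyclotomicLFunctionOf W (ηK.ringHomComp (ι : CyclotomicField 3 ℚ_[3] →+* ℂ_[3])) (ι αK) μ)
    (ψ : DirichletCharacter (CyclotomicField 3 ℚ_[3]) 9)
    (hψ : ψ.ringHomComp (σ : CyclotomicField 3 ℚ_[3] →+* CyclotomicField 3 ℚ_[3]) = ψ⁻¹) :
    ∃ μ' : (n : ℕ) → ZMod (3 ^ n) → ℂ_[3],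
      IsPSCyclotomicLFunctionOf W (ηK.ringHomComp (ι : CyclotomicField 3 ℚ_[3] →+* ℂ_[3]))⁻¹ (ι (σ αK))
        μ' ∧
      (∀ (Dh : W.PSLineHeightData (CyclotomicField 3 ℚ_[3])) (P Q : W.toAffine.Point)
          (κ : CyclotomicField 3 ℚ_[3]) (q : ℚ),
        gammaMahlerCoeff 3 μ 1 = ι κ * (q : ℂ_[3]) * ι (Dh.pairing ψ P Q) →
          gammaMahlerCoeff 3 μ' 1 = ι (σ κ) * (q : ℂ_[3]) * ι (Dh.pairing ψ⁻¹ P Q)) ∧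
      (∀ (Dh : W.PSLineHeightData (CyclotomicField 3 ℚ_[3])) (P Q : W.toAffine.Point) (A : ℝ),
        ‖gammaMahlerCoeff 3 μ 1‖ = A * ‖ι (Dh.pairing ψ P Q)‖ →
          ‖gammaMahlerCoeff 3 μ' 1‖ = A * ‖ι (Dh.pairing ψ⁻¹ P Q)‖) := by
  obtain ⟨μ', hPS, hGZ, hB⟩ := exists_conj_transfer_of_isPSCyclotomicLFunctionOf ι ηK αK σ hσ hη hα hα3 hμ
  refine ⟨μ', hPS, fun Dh P Q κ q h ↦ ?_, fun Dh P Q A h ↦ ?_⟩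
  · rw [← hψ]; exact hGZ Dh ψ P Q κ q h
  · rw [← hψ]; exact hB Dh ψ P Q A h

/-! ### §3 Granted Carayol: the transfer for ANY conjugate untwisted `L`-function -/

/-- **Transfer to any `𝓛^{η̄}_W`** (granted Carayol's level statement `hlev`, which makes the curve-level D1
object unique): for `μ = 𝓛^{η}_W` and `μ' = 𝓛^{η̄}_W` (root `σ α`), GZ₃ and pBSD₃ for `(μ, ψ)` imply GZ₃ and
pBSD₃ for `(μ', ψ ∘ σ)` with the constant conjugated. [cite: MazurTateTeitelbaum1986Invent, §I.10 and §I.13] [cite: Carayol1986] -/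
theorem conj_transfer_of_isPSCyclotomicLFunctionOf [W.IsElliptic]
    (hlev : ∀ (M : ℕ) [NeZero M], IsNewformOf.level_eq_conductorNorm (N := M))
    (hσ : ηK.ringHomComp (σ : CyclotomicField 3 ℚ_[3] →+* CyclotomicField 3 ℚ_[3]) = ηK⁻¹)
    (hη : ηK.IsPrimitive) (hα : αK ≠ 0) (hα3 : αK ≠ (3 : ℕ))
    {μ μ' : (n : ℕ) → ZMod (3 ^ n) → ℂ_[3]}
    (hμ : IsPSCyclotomicLFunctionOf W (ηK.ringHomComp (ι : CyclotomicField 3 ℚ_[3] →+* ℂ_[3])) (ι αK) μ)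
    (hμ' : IsPSCyclotomicLFunctionOf W (ηK.ringHomComp (ι : CyclotomicField 3 ℚ_[3] →+* ℂ_[3]))⁻¹
      (ι (σ αK)) μ')
    (Dh : W.PSLineHeightData (CyclotomicField 3 ℚ_[3])) (ψ : DirichletCharacter (CyclotomicField 3 ℚ_[3]) 9)
    (P Q : W.toAffine.Point) :
    (∀ (κ : CyclotomicField 3 ℚ_[3]) (q : ℚ),
        gammaMahlerCoeff 3 μ 1 = ι κ * (q : ℂ_[3]) * ι (Dh.pairing ψ P Q) →
          gammaMahlerCoeff 3 μ' 1 = ι (σ κ) * (q : ℂ_[3]) *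
            ι (Dh.pairing (ψ.ringHomComp (σ : CyclotomicField 3 ℚ_[3] →+* CyclotomicField 3 ℚ_[3])) P Q)) ∧
      (∀ A : ℝ, ‖gammaMahlerCoeff 3 μ 1‖ = A * ‖ι (Dh.pairing ψ P Q)‖ →
        ‖gammaMahlerCoeff 3 μ' 1‖ = A *
          ‖ι (Dh.pairing (ψ.ringHomComp (σ : CyclotomicField 3 ℚ_[3] →+* CyclotomicField 3 ℚ_[3])) P Q)‖) := by
  obtain ⟨μ'', hPS, hGZ, hB⟩ := exists_conj_transfer_of_isPSCyclotomicLFunctionOf ι ηK αK σ hσ hη hα hα3 hμ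
  obtain rfl : μ' = μ'' := PSGammaUniqueness.eq_of_isPSCyclotomicLFunctionOf hlev hμ' hPS
  exact ⟨fun κ q h ↦ hGZ Dh ψ P Q κ q h, fun A h ↦ hB Dh ψ P Q A h⟩

end Summit.BirchSwinnertonDyer.BirchSwinnertonDyer.Theorems.PSConjugateGrossZagier

end
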